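import Mathlib
import Literature.MathematicalPhysics.QuantumFieldTheory.YangMillsOS
import Literature.MathematicalPhysics.QuantumFieldTheory.LatticeGaugeProofs
import Literature.MathematicalPhysics.QuantumLattice.GaugeGroupsProofs
import HarnessLib

/-!
# FixedTorusTwoSidedSU

Topic `Literature/MathematicalPhysics/QuantumFieldTheory`. Named literature fact(s) relocated by the gate from `Summits/QuantumFields/YangMills/Theorems/LatticeGapInUVUnits/Negative/RulerReductionFalseOfFixedTorusTwoSidedSU.lean`
(accept-time relocation of `[cite]`d propositions written inline in a Summits proposal; human ruling 2026-08-15).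
Sources: CosteEtAl1985, Luscher1983.

* `Literature.MathematicalPhysics.QuantumFieldTheory.FixedTorusTwoSidedSU`
-/

namespace Literature.MathematicalPhysics.QuantumFieldTheory

open Filter Topology MeasureTheory
open Literature.MathematicalPhysics.QuantumFieldTheory Literature.MathematicalPhysics.QuantumLattice

/-- **H_UV for one `SU(N)`** (hypothesis `H` of this negative lemma; the UV half of the disprover's `StandardScalingSU`):
for some `N ≥ 2` (fundamental representation, Borel σ-algebra) the fixed-torus two-sided `β⁻²` plaquette-covariance
asymptotics with side-uniform `0 < c₀`, `C₀` and arbitrary thresholds `B(L)`: `c₀ β⁻² ≤ n⁸ Cov_{β,L}(P_0^{01}, P_{ne₂}^{01}) ≤ C₀ β⁻²`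
(`1 ≤ n ≤ L/8`), `|Cov_{β,L}(P_x^{ij}, P_y^{i'j'})| dist⁸ ≤ C₀ β⁻²` (`x ≠ y`; `P = N − Re tr U_p`). Believed, OPEN, finite-dimensional;
on tree primitives only (`= ∃ N ≥ 2, FixedTorusTwoSided (suFund N)`, `fixedTorusTwoSidedSU_iff`).
[topic MathematicalPhysics/QuantumFieldTheory] [cite: Luscher1983] [cite: CosteEtAl1985] -/
def FixedTorusTwoSidedSU : Prop :=
  ∃ N : ℕ, 2 ≤ N ∧
    letI : MeasurableSpace (Matrix.specialUnitaryGroup (Fin N) ℂ) := borel _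
    haveI : BorelSpace (Matrix.specialUnitaryGroup (Fin N) ℂ) := ⟨rfl⟩
    ∃ c₀ C₀ : ℝ, 0 < c₀ ∧ ∀ (L : ℕ) [NeZero L], ∃ B : ℝ, ∀ β : ℝ, B ≤ β →
      let P : (Fin 4 → ZMod L) → Fin 4 → Fin 4 →
          Literature.MathematicalPhysics.QuantumFieldTheory.GaugeConfig 4 L (Matrix.specialUnitaryGroup (Fin N) ℂ) → ℝ :=
        fun x i j U => (N : ℝ) -
          ((Literature.MathematicalPhysics.QuantumLattice.fundamentalRep (Fin N))
            (Literature.MathematicalPhysics.QuantumFieldTheory.plaquetteHolonomy U x i j)).trace.re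
      let E : (Literature.MathematicalPhysics.QuantumFieldTheory.GaugeConfig 4 L (Matrix.specialUnitaryGroup (Fin N) ℂ) → ℝ) → ℝ :=
        fun F => Literature.MathematicalPhysics.QuantumFieldTheory.wilsonExpectation (d := 4) (L := L)
          (Literature.MathematicalPhysics.QuantumLattice.fundamentalRep (Fin N)) β F
      let cov : (Literature.MathematicalPhysics.QuantumFieldTheory.GaugeConfig 4 L (Matrix.specialUnitaryGroup (Fin N) ℂ) → ℝ) →
          (Literature.MathematicalPhysics.QuantumFieldTheory.GaugeConfig 4 L (Matrix.specialUnitaryGroup (Fin N) ℂ) → ℝ) → ℝ :=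
        fun F F' => E (fun U => F U * F' U) - E F * E F'
      let dist : (Fin 4 → ZMod L) → (Fin 4 → ZMod L) → ℝ :=
        fun x y => Real.sqrt (∑ k : Fin 4, (((x k - y k).valMinAbs : ℤ) : ℝ) ^ 2)
      (∀ n : ℕ, 1 ≤ n → 8 * n ≤ L →
          c₀ * (β ^ 2)⁻¹ ≤ (n : ℝ) ^ 8 * cov (P 0 0 1) (P (Pi.single (2 : Fin 4) ((n : ℕ) : ZMod L)) 0 1) ∧
            (n : ℝ) ^ 8 * cov (P 0 0 1) (P (Pi.single (2 : Fin 4) ((n : ℕ) : ZMod L)) 0 1) ≤ C₀ * (β ^ 2)⁻¹) ∧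
        (∀ (x y : Fin 4 → ZMod L) (i j i' j' : Fin 4), x ≠ y → i ≠ j → i' ≠ j' →
          |cov (P x i j) (P y i' j')| * dist x y ^ 8 ≤ C₀ * (β ^ 2)⁻¹)

end Literature.MathematicalPhysics.QuantumFieldTheory
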